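import Summits.BirchSwinnertonDyer.Rank1Residual.X11b.BDPRouteManin
import Literature.NumberTheory.EllipticCurves.Rank1Residual.GVParityTwistTransportProofs
import HarnessLib

/-!
# Class X11b, route "BDP + converse-theorem engine + Kolyvagin" (p2): the first DEGREE LINK is a theorem — `ord_p deg φ = ord_p δ_{1,N}` for every Manin-good datum when `E[p]` is irreducible (cell `b2b-bsdres`, sub-cell `multr1-p2`, gen 12)

HONEST FRAMING (verbatim, cell `b2b-bsdres`): the goal of the cell is to DELETE the
COMBINATION-SHAPED residual classes for ALL analytic-rank `≤ 1` curves over `ℚ` — "full BSD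
formula for every rank `≤ 1` curve in class `C`" assembled STRICTLY from published theorems — so
that the rank-`≤ 1` remainder becomes exactly the CONSTRUCTION-SHAPED classes, which are TYPED
(missing-input Props), NOT attempted; this is not "finishing BSD". Research route `p2` for class
X11b; no claim beyond the stated class; nothing booked; X11b stays CONSTRUCTION-SHAPED. THEOREMS
ONLY (no definition, no named fact, no `sorry`).

## Content

The typed Shimura-curve input (T2♯-ℝ) of route p2 (`P2ShimuraInputAt`, `BDPRouteRecord.lean`)
carries, at every JSW §7.4.2 field and every modular-parametrisation datum `Dt` of `E` with
`p ∤ c(Dt)`, the **degree link** `ord_p deg φ_{Dt} = ord_p δ(N,1)` between the degree of OUR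
parametrisation and Pasten's minimal degree `δ_{1,N}` of the isogeny class (the optimal quotient
`X₀(N) → A_{1,N}`), flagged in the route's ledgers as "optimal-quotient vocabulary missing". The
vocabulary is in the tree (`exists_optimal_modularParametrizationData`: the optimal datum `D₀` of
the class, `ShimuraCurveRibetTakahashi.lean`; `ModularParametrizationData.modularDegree_eq_card_ker_mul`:
`deg φ_D = [Λ_E : c Λ_f] · δ_{1,N}`, `ModularCurveManinSemistableProofs.lean`), and the link is a
THEOREM:

* `zsmul_eq_zero_of_mem_ker_isogenyMap` — for globally minimal `E ~ E₀` with `E[p]` irreducible,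
  `D₀` an optimal datum of `E₀` (`Λ_{E₀} = c₀ Λ_f`) and `Dt` any datum of `E` with the same
  newform and `p ∤ c(Dt)`: every element of `ker(z ↦ c z : ℂ/Λ_f → ℂ/Λ_E)` is killed by an
  integer prime to `p`. Indeed `c/c₀` maps `Λ_{E₀}` into `Λ_E`, so it is an INTEGER `k'` (Néron
  mapping property for the two minimal models, `integral_neronScaling_of_isGloballyMinimal`), and
  `p ∤ k'` as `p ∤ c = k' c₀`; a cyclic isogeny back gives an integer `q'` prime to `p` with
  `q' Λ_E ⊆ Λ_{E₀}` (`exists_int_mul_mem_lattice_not_dvd`, irreducibility being an isogeny-class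
  invariant); and `c w ∈ Λ_E ⟹ q' k' c₀ w ∈ Λ_{E₀} = c₀ Λ_f ⟹ (q'k') w ∈ Λ_f`.
* `not_dvd_natCard_ker_isogenyMap` — hence `p ∤ [Λ_E : c Λ_f]` (Cauchy).
* `padicValNat_modularDegree_eq_of_not_dvd_maninConstant` — **the link**: with `D₀` of minimal
  degree among all data with the newform of `E` (Pasten's `δ_{1,N} = deg D₀`),
  `ord_p deg φ_{Dt} = ord_p δ_{1,N}` for EVERY datum `Dt` of `E` with `p ∤ c(Dt)`.
* `padicValNat_modularDegree_eq_of_modularity` — the same at the optimal datum supplied by the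
  Modularity theorem (`exists_optimal_modularParametrizationData_of_modularity`), the newform being
  unique (`IsNewformOf.unique`).

Used by `BDPRouteRecordPinned.lean` to DELETE the degree link from the typed input (it is replaced
by the print-faithful pin `δ ∅ = δ_{1,N} := deg D₀`). Nothing booked; labels unchanged.

References: [PastenShimura2024] §2 p. 12 (`δ_{1,N}`, `q_{1,N}`), §3 p. 13; [AgasheRibetStein2006]
§2; [SilvermanATAEC1994] IV.5.1, IV.6.1, Cor. IV.9.1; [SilvermanAEC2009] III.4.11, VI.4.1;
[Knapp1993] Prop. 12.9; [JetchevSkinnerWan2017] §7.4.1 Remark 43 (`p ∤ c_E`).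
-/

noncomputable section

open scoped Classical

open WeierstrassCurve NumberField Literature.NumberTheory.EllipticCurves
  Literature.NumberTheory.EllipticCurves.ModularForms
  Literature.NumberTheory.EllipticCurves.Rank1Residual
  Literature.NumberTheory.Automorphic

namespace Summit.BirchSwinnertonDyer.Rank1Residual.X11b

/-! ### The kernel of `z ↦ c z : ℂ/Λ_f → ℂ/Λ_E` is killed by an integer prime to `p` -/

/-- **Every element of `ker(z ↦ c z : ℂ/Λ_f → ℂ/Λ_E)` is killed by an integer prime to `p`.**
Setting: `E ~ E₀` globally minimal, `E[p]` irreducible, `D₀` an OPTIMAL datum of `E₀`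
(`Λ_{E₀} = c₀ Λ_f`), `Dt` a datum of `E` with the same newform and `p ∤ c = c(Dt)`. Then
`c/c₀ = k' ∈ ℤ` (Néron mapping property, `integral_neronScaling_of_isGloballyMinimal`, since
`(c/c₀) Λ_{E₀} = c Λ_f ⊆ Λ_E`), `p ∤ k'`, and for an integer `q'` prime to `p` with
`q' Λ_E ⊆ Λ_{E₀}` (`exists_int_mul_mem_lattice_not_dvd`): `c w ∈ Λ_E` forces
`(q' k') w ∈ c₀⁻¹ Λ_{E₀} = Λ_f`. [cite: SilvermanATAEC1994, IV.5.1 with IV.6.1 and Cor. IV.9.1]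
[cite: SilvermanAEC2009, Thm. VI.4.1(b)] -/
theorem zsmul_eq_zero_of_mem_ker_isogenyMap (hNS : integral_neronScaling_of_isGloballyMinimal)
    {N : ℕ} [NeZero N] {W W₀ : WeierstrassCurve ℚ} [W.IsElliptic] [W.IsGloballyMinimal]
    [W₀.IsElliptic] [W₀.IsGloballyMinimal] (hiso : IsIsogenous W W₀)
    (D₀ : ModularParametrizationData W₀ N) (Dt : ModularParametrizationData W N)
    (hf : Dt.f = D₀.f) (hopt : ∀ z ∈ D₀.L.lattice, ∃ w ∈ periodLattice D₀.f, z = D₀.c * w)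
    {p : ℕ} (hp : p.Prime) (hirr : W.HasIrreducibleModPGaloisRep p) (hc : ¬ (p : ℤ) ∣ Dt.c) :
    ∃ m : ℤ, ¬ (p : ℤ) ∣ m ∧ ∀ x ∈ Dt.isogenyMap.ker, m • x = 0 := by
  haveI : Fact p.Prime := ⟨hp⟩
  have hc₀ℚ : (D₀.c : ℚ) ≠ 0 := Int.cast_ne_zero.mpr D₀.maninConstant_ne_zero_holds
  have hc₀ℂ : (D₀.c : ℂ) ≠ 0 := D₀.cast_c_ne_zero
  -- `q = c / c₀` maps `Λ_{E₀} = c₀ Λ_f` into `Λ_E`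
  have hq : ∀ z ∈ D₀.L.lattice, (((Dt.c : ℚ) / D₀.c : ℚ) : ℂ) * z ∈ Dt.L.lattice := by
    intro z hz
    obtain ⟨w, hw, rfl⟩ := hopt z hz
    have h1 : (((Dt.c : ℚ) / D₀.c : ℚ) : ℂ) * ((D₀.c : ℂ) * w) = (Dt.c : ℂ) * w := by
      push_cast
      field_simp
    rw [h1]
    exact Dt.smul_periodLattice_le w (hf ▸ hw)
  -- hence it is an integer `k'` (Néron mapping property), `c = k' c₀`, `p ∤ k'`
  obtain ⟨k', hk'⟩ := hNS W₀ W D₀.L Dt.L D₀.isNeronLattice Dt.isNeronLattice _ hq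
  have hck : Dt.c = k' * D₀.c := by
    have h1 : (Dt.c : ℚ) = k' * D₀.c := by
      rw [hk', div_mul_cancel₀ _ hc₀ℚ]
    exact_mod_cast h1
  have hpk' : ¬ (p : ℤ) ∣ k' := fun h ↦ hc (hck ▸ dvd_mul_of_dvd_left h _)
  -- a reverse integral multiplier `q' : Λ_E → Λ_{E₀}` prime to `p` (irreducibility passes to `E₀`)
  have hirr₀ : W₀.HasIrreducibleModPGaloisRep p := by
    by_contra hred
    exact not_hasIrreducibleModPGaloisRep_of_isIsogenous hiso.symm_of_charZero hred hirr
  obtain ⟨q', -, hpq', hq'⟩ :=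
    exists_int_mul_mem_lattice_not_dvd hNS hiso Dt.isNeronLattice D₀.isNeronLattice hp hirr₀
  refine ⟨q' * k', fun h ↦ ?_, fun x hx ↦ ?_⟩
  · rcases (Int.prime_iff_natAbs_prime.mpr (by simpa using hp)).dvd_or_dvd h with h | h
    · exact hpq' h
    · exact hpk' h
  · induction x using QuotientAddGroup.induction_on with
    | H w =>
      -- `c w ∈ Λ_E`
      have hcw : (Dt.c : ℂ) * w ∈ Dt.L.lattice := by
        have h0 : Dt.isogenyMap (w : ℂ ⧸ periodLattice Dt.f) = 0 := hx
        rw [Dt.isogenyMap_mk, QuotientAddGroup.eq_zero_iff] at h0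
        exact h0
      -- `q' c w ∈ Λ_{E₀} = c₀ Λ_f`
      obtain ⟨w', hw', hqcw⟩ := hopt _ (hq' _ hcw)
      -- `(q' k') w = w' ∈ Λ_f`
      have hmul : ((q' * k' : ℤ) : ℂ) * w = w' := by
        apply mul_left_cancel₀ hc₀ℂ
        rw [← hqcw, hck]
        push_cast
        ring
      have hmem : ((q' * k' : ℤ) : ℂ) * w ∈ periodLattice Dt.f := by
        rw [hmul, hf]
        exact hw'
      change (q' * k') • ((w : ℂ) : ℂ ⧸ periodLattice Dt.f) = 0
      rw [← QuotientAddGroup.mk_zsmul, QuotientAddGroup.eq_zero_iff, zsmul_eq_mul]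
      exact hmem

/-- **`p ∤ [Λ_E : c Λ_f] = # ker(z ↦ c z : ℂ/Λ_f → ℂ/Λ_E)`** in the setting of
`zsmul_eq_zero_of_mem_ker_isogenyMap` (finite kernel): an element of order `p` (Cauchy) would be
killed by an integer prime to `p`. [cite: SilvermanAEC2009, Thm. VI.4.1(b)] -/
theorem not_dvd_natCard_ker_isogenyMap (hNS : integral_neronScaling_of_isGloballyMinimal)
    {N : ℕ} [NeZero N] {W W₀ : WeierstrassCurve ℚ} [W.IsElliptic] [W.IsGloballyMinimal]
    [W₀.IsElliptic] [W₀.IsGloballyMinimal] (hiso : IsIsogenous W W₀)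
    (D₀ : ModularParametrizationData W₀ N) (Dt : ModularParametrizationData W N)
    (hf : Dt.f = D₀.f) (hopt : ∀ z ∈ D₀.L.lattice, ∃ w ∈ periodLattice D₀.f, z = D₀.c * w)
    {p : ℕ} (hp : p.Prime) (hirr : W.HasIrreducibleModPGaloisRep p) (hc : ¬ (p : ℤ) ∣ Dt.c)
    [Finite Dt.isogenyMap.ker] : ¬ p ∣ Nat.card Dt.isogenyMap.ker := by
  haveI : Fact p.Prime := ⟨hp⟩
  intro hdvd
  obtain ⟨m, hpm, hm⟩ := zsmul_eq_zero_of_mem_ker_isogenyMap hNS hiso D₀ Dt hf hopt hp hirr hc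
  obtain ⟨x, hx⟩ := exists_prime_addOrderOf_dvd_card' (G := Dt.isogenyMap.ker) p hdvd
  have h0 : m • x = 0 := Subtype.ext (by simpa using hm x.1 x.2)
  have h1 : (addOrderOf x : ℤ) ∣ m := (addOrderOf_dvd_iff_zsmul_eq_zero).mpr h0
  rw [hx] at h1
  exact hpm h1

/-! ### The degree link -/

/-- **DEGREE LINK (first): `ord_p deg φ_{Dt} = ord_p δ_{1,N}` for every Manin-good datum of a
curve with irreducible `E[p]`.** For globally minimal `E ~ E₀`, `D₀` a datum of `E₀` of MINIMAL
degree among all data (of all curves) with that newform — Pasten's `δ_{1,N} = deg D₀`, the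
degree of the optimal quotient `X₀(N) → A_{1,N}` ([PastenShimura2024] §2 p. 12) — and any datum
`Dt` of `E` with the same newform and `p ∤ c(Dt)`: `ord_p deg φ_{Dt} = ord_p deg D₀`. Minimal
degree forces `Λ_{E₀} = c₀ Λ_f` (`latticeEq_of_modularDegree_le`), the degree formula gives
`deg φ_{Dt} = [Λ_E : c Λ_f] · deg D₀` (`modularDegree_eq_card_ker_mul`), and
`p ∤ [Λ_E : c Λ_f]` (`not_dvd_natCard_ker_isogenyMap`). [cite: PastenShimura2024, §2 p. 12 and §3 p. 13]
[cite: Knapp1993, Prop. 12.9] [cite: JetchevSkinnerWan2017, §7.4.1 and Remark 43] -/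
theorem padicValNat_modularDegree_eq_of_not_dvd_maninConstant
    (hNS : integral_neronScaling_of_isGloballyMinimal)
    {N : ℕ} [NeZero N] {W W₀ : WeierstrassCurve ℚ} [W.IsElliptic] [W.IsGloballyMinimal]
    [W₀.IsElliptic] [W₀.IsGloballyMinimal] (hiso : IsIsogenous W W₀)
    (D₀ : ModularParametrizationData W₀ N) (Dt : ModularParametrizationData W N)
    (hf : Dt.f = D₀.f)
    (hmin : ∀ (W₂ : WeierstrassCurve ℚ) [W₂.IsElliptic] (D₂ : ModularParametrizationData W₂ N),
      D₂.f = D₀.f → D₀.modularDegree ≤ D₂.modularDegree)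
    {p : ℕ} (hp : p.Prime) (hirr : W.HasIrreducibleModPGaloisRep p) (hc : ¬ (p : ℤ) ∣ Dt.c) :
    padicValNat p Dt.modularDegree = padicValNat p D₀.modularDegree := by
  haveI : Fact p.Prime := ⟨hp⟩
  -- minimal degree forces optimality `Λ_{E₀} = c₀ Λ_f`
  obtain ⟨W₁, hW₁, D₁, hf₁, h₁⟩ := D₀.exists_optimalDatum'
  haveI := hW₁
  have hopt : ∀ z ∈ D₀.L.lattice, ∃ w ∈ periodLattice D₀.f, z = D₀.c * w :=
    D₀.latticeEq_of_modularDegree_le D₁ hf₁ h₁ (hmin W₁ D₁ hf₁)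
  have hinj : Function.Injective D₀.isogenyMap :=
    (AddMonoidHom.ker_eq_bot_iff _).mp (D₀.isogenyMap_ker_eq_bot_iff.mpr hopt)
  -- the degree formula `deg φ_{Dt} = [Λ_E : c Λ_f] · deg D₀`
  obtain ⟨hfin, hdeg⟩ := Dt.modularDegree_eq_card_ker_mul hf D₀.smul_periodLattice_le hinj
    D₀.deg_pos D₀.finite_setOf_natCard_fiberOrbits_ne
  haveI := hfin
  have hker : ¬ p ∣ Nat.card Dt.isogenyMap.ker :=
    not_dvd_natCard_ker_isogenyMap hNS hiso D₀ Dt hf hopt hp hirr hc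
  have hk0 : Nat.card Dt.isogenyMap.ker ≠ 0 := Nat.card_pos.ne'
  rw [hdeg, padicValNat.mul hk0 D₀.deg_pos.ne', padicValNat.eq_zero_of_not_dvd hker, zero_add]
  rfl

/-- **The degree link at the optimal datum of the Modularity theorem.** For a globally minimal
elliptic `E/ℚ` of conductor `N` with `E[p]` irreducible, the optimal datum `D₀` of the class
(`exists_optimal_modularParametrizationData_of_modularity`: `E₀ ~ E` globally minimal, `D₀` of
minimal degree among all data with the newform of `E`) and EVERY datum `Dt` of `E` with
`p ∤ c(Dt)` satisfy `ord_p deg φ_{Dt} = ord_p deg D₀` (the newform of `E` is unique,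
`IsNewformOf.unique`). [cite: PastenShimura2024, §2 p. 12] [cite: JetchevSkinnerWan2017, §7.4.1 and Remark 43] -/
theorem padicValNat_modularDegree_eq_of_isNewformOf
    (hNS : integral_neronScaling_of_isGloballyMinimal)
    {N : ℕ} [NeZero N] {W W₀ : WeierstrassCurve ℚ} [W.IsElliptic] [W.IsGloballyMinimal]
    [W₀.IsElliptic] [W₀.IsGloballyMinimal] (hiso : IsIsogenous W W₀)
    (D₀ : ModularParametrizationData W₀ N) (hfW : IsNewformOf W D₀.f)
    (hmin : ∀ (W₂ : WeierstrassCurve ℚ) [W₂.IsElliptic] (D₂ : ModularParametrizationData W₂ N),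
      D₂.f = D₀.f → D₀.modularDegree ≤ D₂.modularDegree)
    {p : ℕ} (hp : p.Prime) (hirr : W.HasIrreducibleModPGaloisRep p)
    (Dt : ModularParametrizationData W N) (hc : ¬ (p : ℤ) ∣ Dt.c) :
    padicValNat p Dt.modularDegree = padicValNat p D₀.modularDegree :=
  padicValNat_modularDegree_eq_of_not_dvd_maninConstant hNS hiso D₀ Dt (Dt.isNewformOf.unique hfW)
    hmin hp hirr hc

end Summit.BirchSwinnertonDyer.Rank1Residual.X11b

end
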